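import Summits.Ventures.Crystal3D.Theorems.StickyWulffConstantCoaxialWallLawForeignTilt
import Summits.Ventures.Crystal3D.Theorems.StickyWulffConstantNoReconstructionGainSymmetry
import Mathlib.Data.ZMod.Basic
import HarnessLib

/-!
# Twin chains form a tree: reduced words of `{111}` mirrors and the unique terminal twin family

HONEST FRAMING. Venture `Summits/Ventures/Crystal3D` (cell `crystal3d-full`), helper for the crux
`GenericWallFloor` (stmt-Ventures-19480) of `route-Ventures-StickyWulffConstant`, REGISTERED line `WallLedgerG`,
open stub `stub_twoSlabAdhesion` (general fillings; the `Σ3ⁿ` chain pairs).  Rung credit only; F-C1 not moved.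

The frames a coherent walk can carry are `A₁ ∘ S_{ν₁} ∘ ⋯ ∘ S_{ν_k}` for model `{111}` reflections `S_ν`
(`ν ∈ {(1,1,1), (1,1,−1), (1,−1,1), (1,−1,−1)}/√3` in the cubic frame, four classes).  This file proves the
TREE PROPERTY of twin chains (folklore in the CSL literature, «an `n`-th order twin chain is `Σ3ⁿ`»; cf-p1
ROUTE.md l.1388): in cubic coordinates `3^k · (S_{ν₁} ⋯ S_{ν_k})` is an integer matrix which, for a REDUCED word
(consecutive classes distinct, `k ≥ 1`), is `≡ w ⊗ ν_k ≢ 0 (mod 3)` (`wordMat_mod3`); a lattice-preserving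
product would be `≡ 0 (mod 3)` (`dvd_three_of_mapsTo`), so nonempty reduced words never preserve `Λ₀`
(`not_mapsTo_of_reduced`) and two reduced words with the same image lattice are EQUAL
(`eq_of_isChain_of_image_eq`).  Vocabulary: `diagInt`, `diagVec` (the four class representatives), `twinGen`
(the model reflection), `wordMap` / `wordMat` (products).  The walk-facing consequence (unique terminal twin
family of a chain pair) is in the next file.
WHAT THIS IS NOT: any statement about packings; F-C1 not moved.
-/

noncomputable section

namespace Summit.Ventures.Crystal3D.Theorems

open Summit.Ventures.Crystal3D Finset Matrix NearIdentity
open Literature.MathematicalPhysics.StatisticalMechanics (fccStacking)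
open scoped InnerProductSpace

/-- The four classes of `{111}` directions as integer cubic triples (first four rows of `cubeInt`). -/
def diagInt : Fin 4 → Fin 3 → ℤ := ![![1, 1, 1], ![1, 1, -1], ![1, -1, 1], ![1, -1, -1]]

/-- The model unit normal of class `c`: cubic coordinates `diagInt c / √3`. -/
def diagVec (c : Fin 4) : EuclideanSpace ℝ (Fin 3) :=
  (Real.sqrt 3)⁻¹ • ∑ i : Fin 3, (diagInt c i : ℝ) • cubicFrame i

/-- The model `{111}` reflection of class `c`. -/
def twinGen (c : Fin 4) : EuclideanSpace ℝ (Fin 3) ≃ₗᵢ[ℝ] EuclideanSpace ℝ (Fin 3) :=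
  (ℝ ∙ diagVec c)ᗮ.reflection

/-- The product of a word of model reflections (head applied first): `wordMap (c :: P) = wordMap P ∘ twinGen c`. -/
def wordMap : List (Fin 4) → (EuclideanSpace ℝ (Fin 3) ≃ₗᵢ[ℝ] EuclideanSpace ℝ (Fin 3))
  | [] => LinearIsometryEquiv.refl ℝ _
  | c :: P => (twinGen c).trans (wordMap P)

/-- `3 ×` the cubic matrix of `twinGen c`: `3δᵢⱼ − 2 νᵢ νⱼ`. -/
def genMat (c : Fin 4) : Matrix (Fin 3) (Fin 3) ℤ :=
  Matrix.of fun i j => 3 * (if i = j then 1 else 0) - 2 * diagInt c i * diagInt c j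

/-- `3^|P| ×` the cubic matrix of `wordMap P`. -/
def wordMat : List (Fin 4) → Matrix (Fin 3) (Fin 3) ℤ
  | [] => 1
  | c :: P => wordMat P * genMat c

/-! ### The class representatives -/

/-- Entries of `diagInt` are `±1`. -/
theorem diagInt_sq (c : Fin 4) (i : Fin 3) : diagInt c i * diagInt c i = 1 := by
  fin_cases c <;> fin_cases i <;> decide

/-- Cubic coordinates of the class representative. -/
theorem cubicCoords_diagVec (c : Fin 4) (i : Fin 3) : cubicCoords (diagVec c) i = (diagInt c i : ℝ) / Real.sqrt 3 := by
  rw [diagVec, cubicCoords_smul, Fin.sum_univ_three, cubicCoords_add, cubicCoords_add, cubicCoords_smul,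
    cubicCoords_smul, cubicCoords_smul, cubicCoords_cubicFrame, cubicCoords_cubicFrame, cubicCoords_cubicFrame]
  fin_cases i <;> simp <;> ring

/-- The class representative is a unit vector. -/
theorem norm_diagVec (c : Fin 4) : ‖diagVec c‖ = 1 := by
  have h3 : Real.sqrt 3 ^ 2 = 3 := Real.sq_sqrt (by norm_num)
  have h : ‖diagVec c‖ ^ 2 = 1 := by
    rw [norm_sq_eq_cubicCoords]
    simp only [dotProduct, Fin.sum_univ_three, cubicCoords_diagVec]
    have e : ∀ i, (diagInt c i : ℝ) / Real.sqrt 3 * ((diagInt c i : ℝ) / Real.sqrt 3) =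
        ((diagInt c i * diagInt c i : ℤ) : ℝ) / 3 := by
      intro i; push_cast; field_simp; rw [h3]
    rw [e, e, e, diagInt_sq, diagInt_sq, diagInt_sq]; norm_num
  nlinarith [norm_nonneg (diagVec c)]

/-- `⟪x, ν_c⟫ = (ν_c · cubicCoords x)/√3`. -/
theorem inner_diagVec (c : Fin 4) (x : EuclideanSpace ℝ (Fin 3)) :
    ⟪x, diagVec c⟫_ℝ = (∑ i : Fin 3, (diagInt c i : ℝ) * cubicCoords x i) / Real.sqrt 3 := by
  rw [inner_eq_cubicCoords]
  simp only [dotProduct, Fin.sum_univ_three, cubicCoords_diagVec]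
  field_simp

/-! ### The model reflection -/

/-- Formula for the model reflection. -/
theorem twinGen_apply (c : Fin 4) (x : EuclideanSpace ℝ (Fin 3)) :
    twinGen c x = x - (2 * ⟪x, diagVec c⟫_ℝ) • diagVec c := by
  rw [twinGen, bondReflection_apply _ _ (norm_diagVec c), real_inner_comm]

/-- The model reflection is an involution. -/
theorem twinGen_twinGen (c : Fin 4) (x : EuclideanSpace ℝ (Fin 3)) : twinGen c (twinGen c x) = x := by
  rw [twinGen]; exact Submodule.reflection_reflection _ _

/-- Cubic coordinates of the model reflection: `cubicCoords (S_c x) = (1/3) · genMat c · cubicCoords x`. -/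
theorem cubicCoords_twinGen (c : Fin 4) (x : EuclideanSpace ℝ (Fin 3)) :
    cubicCoords (twinGen c x) = (1 / 3 : ℝ) • ((genMat c).map (Int.cast : ℤ → ℝ) *ᵥ cubicCoords x) := by
  have h3 : Real.sqrt 3 ^ 2 = 3 := Real.sq_sqrt (by norm_num)
  have h30 : Real.sqrt 3 ≠ 0 := by positivity
  rw [twinGen_apply, cubicCoords_sub, cubicCoords_smul, inner_diagVec]
  ext i
  simp only [Pi.sub_apply, Pi.smul_apply, smul_eq_mul, cubicCoords_diagVec, mulVec, dotProduct,
    Matrix.map_apply, genMat, Matrix.of_apply, Fin.sum_univ_three]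
  push_cast
  field_simp
  rw [h3]
  fin_cases i <;> simp <;> try ring

/-! ### Words -/

/-- `wordMap (c :: P) x = wordMap P (twinGen c x)`. -/
theorem wordMap_cons_apply (c : Fin 4) (P : List (Fin 4)) (x : EuclideanSpace ℝ (Fin 3)) :
    wordMap (c :: P) x = wordMap P (twinGen c x) := rfl

/-- `wordMap [] = id`. -/
theorem wordMap_nil_apply (x : EuclideanSpace ℝ (Fin 3)) : wordMap [] x = x := rfl

/-- `wordMap (P ++ Q) = wordMap Q ∘ wordMap P`. -/
theorem wordMap_append_apply (P Q : List (Fin 4)) (x : EuclideanSpace ℝ (Fin 3)) :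
    wordMap (P ++ Q) x = wordMap Q (wordMap P x) := by
  induction P generalizing x with
  | nil => rfl
  | cons c P ih => rw [List.cons_append, wordMap_cons_apply, wordMap_cons_apply, ih]

/-- Two equal consecutive letters cancel. -/
theorem wordMap_cons_cons_apply (c : Fin 4) (P : List (Fin 4)) (x : EuclideanSpace ℝ (Fin 3)) :
    wordMap (c :: c :: P) x = wordMap P x := by
  rw [wordMap_cons_apply, wordMap_cons_apply, twinGen_twinGen]

/-- The reversed word is the inverse. -/
theorem wordMap_reverse_apply (P : List (Fin 4)) (x : EuclideanSpace ℝ (Fin 3)) :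
    wordMap P.reverse (wordMap P x) = x := by
  induction P generalizing x with
  | nil => rfl
  | cons c P ih =>
    rw [wordMap_cons_apply, List.reverse_cons, wordMap_append_apply, ih, wordMap_cons_apply, wordMap_nil_apply,
      twinGen_twinGen]

/-- The reversed word is the inverse (other order). -/
theorem wordMap_apply_reverse (P : List (Fin 4)) (x : EuclideanSpace ℝ (Fin 3)) :
    wordMap P (wordMap P.reverse x) = x := by
  have := wordMap_reverse_apply P.reverse x
  rwa [List.reverse_reverse] at this

/-- **Cubic matrix of a word:** `cubicCoords (wordMap P x) = 3^{-|P|} · wordMat P · cubicCoords x`. -/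
theorem cubicCoords_wordMap (P : List (Fin 4)) (x : EuclideanSpace ℝ (Fin 3)) :
    cubicCoords (wordMap P x) = ((1 / 3 : ℝ) ^ P.length) • ((wordMat P).map (Int.cast : ℤ → ℝ) *ᵥ cubicCoords x) := by
  induction P generalizing x with
  | nil => simp [wordMap_nil_apply, wordMat, Matrix.map_one]
  | cons c P ih =>
    have hmul : (wordMat P * genMat c).map (Int.cast : ℤ → ℝ) =
        (wordMat P).map (Int.cast : ℤ → ℝ) * (genMat c).map (Int.cast : ℤ → ℝ) :=
      Matrix.map_mul (f := Int.castRingHom ℝ)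
    rw [wordMap_cons_apply, ih, cubicCoords_twinGen, wordMat, List.length_cons, pow_succ, hmul,
      ← mulVec_mulVec, mulVec_smul, smul_smul]

/-! ### The `mod 3` invariant -/

/-- `genMat c ≡ ν_c ⊗ ν_c (mod 3)`. -/
theorem genMat_mod3 (c : Fin 4) (i j : Fin 3) :
    ((genMat c i j : ℤ) : ZMod 3) = (diagInt c i : ZMod 3) * (diagInt c j : ZMod 3) := by
  fin_cases c <;> fin_cases i <;> fin_cases j <;> decide

/-- Representatives of distinct classes have dot product `±1`, i.e. a unit `mod 3`. -/
theorem diagInt_dot_unit (c d : Fin 4) (h : c ≠ d) :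
    (∑ l : Fin 3, (diagInt d l : ZMod 3) * (diagInt c l : ZMod 3)) = 1 ∨
      (∑ l : Fin 3, (diagInt d l : ZMod 3) * (diagInt c l : ZMod 3)) = -1 := by
  fin_cases c <;> fin_cases d <;> first | exact absurd rfl h | decide

/-- Entries of the representatives are units `mod 3`. -/
theorem diagInt_mod3_ne_zero (c : Fin 4) (j : Fin 3) : (diagInt c j : ZMod 3) ≠ 0 := by
  fin_cases c <;> fin_cases j <;> decide

/-- **The invariant:** for a reduced word with head `c`, `wordMat ≡ w ⊗ ν_c (mod 3)` with `w ≢ 0`. -/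
theorem wordMat_mod3 : ∀ (P : List (Fin 4)) (c : Fin 4), (c :: P).IsChain (· ≠ ·) →
    ∃ w : Fin 3 → ZMod 3, w ≠ 0 ∧ ∀ i j, ((wordMat (c :: P) i j : ℤ) : ZMod 3) = w i * (diagInt c j : ZMod 3)
  | [], c, _ => by
    refine ⟨fun i => (diagInt c i : ZMod 3), ?_, fun i j => ?_⟩
    · intro h
      have := congrFun h 0
      exact diagInt_mod3_ne_zero c 0 this
    · rw [wordMat, wordMat, Matrix.one_mul, genMat_mod3]
  | d :: P, c, h => by
    rw [List.isChain_cons_cons] at h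
    obtain ⟨hcd, h'⟩ := h
    obtain ⟨w, hw, hrepr⟩ := wordMat_mod3 P d h'
    set s : ZMod 3 := ∑ l : Fin 3, (diagInt d l : ZMod 3) * (diagInt c l : ZMod 3) with hs
    have hsu : s = 1 ∨ s = -1 := diagInt_dot_unit c d hcd
    refine ⟨fun i => w i * s, ?_, fun i j => ?_⟩
    · intro h0
      apply hw
      funext i
      have hi := congrFun h0 i
      simp only [Pi.zero_apply] at hi ⊢
      rcases hsu with h1 | h1 <;> rw [h1] at hi
      · simpa using hi
      · simpa using hi
    · rw [wordMat, Matrix.mul_apply]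
      push_cast
      simp only [hrepr, genMat_mod3, hs, Finset.sum_mul, Finset.mul_sum]
      refine Finset.sum_congr rfl fun l _ => ?_
      ring

/-- A nonempty reduced word has an entry `≢ 0 (mod 3)`. -/
theorem exists_wordMat_mod3_ne_zero (P : List (Fin 4)) (hP : P.IsChain (· ≠ ·)) (hne : P ≠ []) :
    ∃ i j, ((wordMat P i j : ℤ) : ZMod 3) ≠ 0 := by
  obtain ⟨c, Q, rfl⟩ := List.exists_cons_of_ne_nil hne
  obtain ⟨w, hw, hrepr⟩ := wordMat_mod3 Q c hP
  obtain ⟨i, hi⟩ : ∃ i, w i ≠ 0 := by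
    by_contra h; push Not at h; exact hw (funext h)
  exact ⟨i, 0, by rw [hrepr]; exact mul_ne_zero hi (diagInt_mod3_ne_zero c 0)⟩

/-! ### Lattice-preserving products are `≡ 0 (mod 3)` -/

/-- The `(i, j)` entry of the cubic matrix of `wordMap P`. -/
theorem cubicCoords_wordMap_cubicFrame (P : List (Fin 4)) (i j : Fin 3) :
    cubicCoords (wordMap P (cubicFrame j)) i = ((1 / 3 : ℝ) ^ P.length) * ((wordMat P i j : ℤ) : ℝ) := by
  rw [cubicCoords_wordMap, cubicCoords_cubicFrame, mulVec_single_one]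
  simp [Matrix.col_apply]

/-- **A lattice-preserving nonempty product is `≡ 0 (mod 3)`:** if `wordMap P` maps `Λ₀` into itself then
(its slot images are slots, the cubic matrix has entries in `½ℤ`, and) `3 ∣ wordMat P i j` for all `i, j`. -/
theorem dvd_three_of_mapsTo (P : List (Fin 4)) (hne : P ≠ [])
    (h : ∀ p ∈ fccStacking 1 (Real.sqrt (2 / 3)), wordMap P p ∈ fccStacking 1 (Real.sqrt (2 / 3))) (i j : Fin 3) :
    (3 : ℤ) ∣ wordMat P i j := by
  have hs2 : Real.sqrt 2 ≠ 0 := by positivity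
  have hs22 : Real.sqrt 2 * Real.sqrt 2 = 2 := Real.mul_self_sqrt (by norm_num)
  set W := wordMap P with hW
  -- slot images are slots: their cubic coordinates are `slotInt / √2`
  have slotImg : ∀ k : Fin 12, ∃ k' : Fin 12, ∀ l, cubicCoords (W (slotSite k)) l = (slotInt k' l : ℝ) / Real.sqrt 2 := by
    intro k
    have hmem : W (slotSite k) ∈ fccStacking 1 (Real.sqrt (2 / 3)) := h _ (mem_fcc_of_mem_fccSlots (slotSite_mem k))
    have hn : ‖W (slotSite k)‖ = 1 := by
      rw [hW, LinearIsometryEquiv.norm_map, norm_eq_one_of_mem_fccSlots (slotSite_mem k)]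
    obtain ⟨k', hk'⟩ := exists_slotSite_eq (mem_fccSlots_of_unit hmem hn)
    refine ⟨k', fun l => ?_⟩
    rw [← hk', cubicCoords_slotSite]; rfl
  -- the entry `(i, j)` is half an integer
  have half : ∃ m : ℤ, cubicCoords (W (cubicFrame j)) i = (m : ℝ) / 2 := by
    obtain ⟨e0, e1, e2⟩ := cubicFrame_eq_slots
    have lin_add : ∀ a b : EuclideanSpace ℝ (Fin 3), cubicCoords (W ((1 / Real.sqrt 2) • (a + b))) i =
        (cubicCoords (W a) i + cubicCoords (W b) i) / Real.sqrt 2 := by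
      intro a b
      rw [LinearIsometryEquiv.map_smul, map_add, cubicCoords_smul, cubicCoords_add]
      simp only [Pi.smul_apply, Pi.add_apply, smul_eq_mul]; ring
    have lin_sub : ∀ a b : EuclideanSpace ℝ (Fin 3), cubicCoords (W ((1 / Real.sqrt 2) • (a - b))) i =
        (cubicCoords (W a) i - cubicCoords (W b) i) / Real.sqrt 2 := by
      intro a b
      rw [LinearIsometryEquiv.map_smul, map_sub, cubicCoords_smul, cubicCoords_sub]
      simp only [Pi.smul_apply, Pi.sub_apply, smul_eq_mul]; ring
    have mk : ∀ (a b : Fin 12) (sgn : ℤ), sgn = 1 ∨ sgn = -1 →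
        ∃ m : ℤ, (cubicCoords (W (slotSite a)) i + sgn * cubicCoords (W (slotSite b)) i) / Real.sqrt 2 = (m : ℝ) / 2 := by
      intro a b sgn hsgn
      obtain ⟨a', ha'⟩ := slotImg a
      obtain ⟨b', hb'⟩ := slotImg b
      refine ⟨slotInt a' i + sgn * slotInt b' i, ?_⟩
      rw [ha', hb']
      have hs2sq : Real.sqrt 2 ^ 2 = 2 := Real.sq_sqrt (by norm_num)
      push_cast
      field_simp
      rw [hs2sq]; ring
    fin_cases j
    · obtain ⟨m, hm⟩ := mk 0 1 1 (Or.inl rfl)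
      refine ⟨m, ?_⟩
      rw [show cubicFrame ((⟨0, by norm_num⟩ : Fin 3)) = cubicFrame 0 from rfl, e0, lin_add, ← hm]; push_cast; ring
    · obtain ⟨m, hm⟩ := mk 0 1 (-1) (Or.inr rfl)
      refine ⟨m, ?_⟩
      rw [show cubicFrame ((⟨1, by norm_num⟩ : Fin 3)) = cubicFrame 1 from rfl, e1, lin_sub, ← hm]; push_cast; ring
    · obtain ⟨m, hm⟩ := mk 4 5 (-1) (Or.inr rfl)
      refine ⟨m, ?_⟩
      rw [show cubicFrame ((⟨2, by norm_num⟩ : Fin 3)) = cubicFrame 2 from rfl, e2, lin_sub, ← hm]; push_cast; ring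
  obtain ⟨m, hm⟩ := half
  rw [cubicCoords_wordMap_cubicFrame] at hm
  -- `2 · wordMat = 3^n · m`
  obtain ⟨n, hn⟩ : ∃ n : ℕ, P.length = n + 1 := Nat.exists_eq_succ_of_ne_zero (by
    intro h0; exact hne (List.length_eq_zero_iff.1 h0))
  rw [hn] at hm
  have h3 : (2 : ℝ) * (wordMat P i j : ℤ) = (3 : ℝ) ^ (n + 1) * (m : ℤ) := by
    have e : (3 : ℝ) ^ (n + 1) * (1 / 3) ^ (n + 1) = 1 := by rw [← mul_pow]; norm_num
    calc (2 : ℝ) * (wordMat P i j : ℤ) = 2 * ((3 : ℝ) ^ (n + 1) * (1 / 3) ^ (n + 1)) * (wordMat P i j : ℤ) := by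
          rw [e]; ring
      _ = 2 * (3 : ℝ) ^ (n + 1) * ((1 / 3) ^ (n + 1) * (wordMat P i j : ℤ)) := by ring
      _ = 2 * (3 : ℝ) ^ (n + 1) * ((m : ℝ) / 2) := by rw [hm]
      _ = (3 : ℝ) ^ (n + 1) * (m : ℤ) := by ring
  have hint : (2 : ℤ) * wordMat P i j = 3 ^ (n + 1) * m := by exact_mod_cast h3
  have hdvd : (3 : ℤ) ∣ 2 * wordMat P i j := ⟨3 ^ n * m, by rw [hint]; ring⟩
  exact (Int.prime_three.dvd_or_dvd hdvd).resolve_left (by norm_num)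

/-- **Nonempty reduced words never preserve the lattice.** -/
theorem not_mapsTo_of_reduced (P : List (Fin 4)) (hP : P.IsChain (· ≠ ·)) (hne : P ≠ []) :
    ¬ ∀ p ∈ fccStacking 1 (Real.sqrt (2 / 3)), wordMap P p ∈ fccStacking 1 (Real.sqrt (2 / 3)) := by
  intro h
  obtain ⟨i, j, hij⟩ := exists_wordMat_mod3_ne_zero P hP hne
  exact hij ((ZMod.intCast_zmod_eq_zero_iff_dvd _ 3).2 (by exact_mod_cast dvd_three_of_mapsTo P hne h i j))

/-! ### Uniqueness of reduced words -/

/-- The image lattice of `wordMap (P ++ [a])` is the `twinGen a`-image of that of `wordMap P`. -/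
theorem image_wordMap_concat (P : List (Fin 4)) (a : Fin 4) (S : Set (EuclideanSpace ℝ (Fin 3))) :
    wordMap (P ++ [a]) '' S = twinGen a '' (wordMap P '' S) := by
  rw [Set.image_image]
  exact Set.image_congr fun x _ => by rw [wordMap_append_apply, wordMap_cons_apply, wordMap_nil_apply]

/-- Reversal preserves reducedness. -/
theorem isChain_ne_reverse {P : List (Fin 4)} (h : P.IsChain (· ≠ ·)) : P.reverse.IsChain (· ≠ ·) :=
  List.isChain_reverse.2 (h.imp fun _ _ hab => Ne.symm hab)

/-- **The tree property:** two reduced words with the same image lattice are equal. -/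
theorem eq_of_isChain_of_image_eq : ∀ (P Q : List (Fin 4)), P.IsChain (· ≠ ·) → Q.IsChain (· ≠ ·) →
    wordMap P '' fccStacking 1 (Real.sqrt (2 / 3)) = wordMap Q '' fccStacking 1 (Real.sqrt (2 / 3)) → P = Q := by
  -- a reduced combined word `P ++ reverse Q` would preserve `Λ₀`
  have key : ∀ P Q : List (Fin 4), (P ++ Q.reverse).IsChain (· ≠ ·) → P ++ Q.reverse ≠ [] →
      wordMap P '' fccStacking 1 (Real.sqrt (2 / 3)) ≠ wordMap Q '' fccStacking 1 (Real.sqrt (2 / 3)) := by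
    intro P Q hred hne heq
    apply not_mapsTo_of_reduced _ hred hne
    intro p hp
    rw [wordMap_append_apply]
    have : wordMap P p ∈ wordMap Q '' fccStacking 1 (Real.sqrt (2 / 3)) := by rw [← heq]; exact ⟨p, hp, rfl⟩
    obtain ⟨q, hq, hqp⟩ := this
    rw [← hqp, wordMap_reverse_apply]; exact hq
  intro P
  induction P using List.reverseRecOn with
  | nil =>
    intro Q _ hQ heq
    rcases List.eq_nil_or_concat Q with rfl | ⟨Q₁, b, rfl⟩
    · rfl
    · exfalso
      simp only [List.concat_eq_append] at hQ heq
      refine key [] (Q₁ ++ [b]) ?_ (by simp) heq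
      rw [List.nil_append]
      exact isChain_ne_reverse hQ
  | append_singleton P₁ a ih =>
    intro Q hP hQ heq
    rcases List.eq_nil_or_concat Q with rfl | ⟨Q₁, b, rfl⟩
    · exfalso
      exact key (P₁ ++ [a]) [] (by rw [List.reverse_nil, List.append_nil]; exact hP) (by simp) heq
    · simp only [List.concat_eq_append] at hQ heq ⊢
      by_cases hab : a = b
      · subst hab
        have hP₁ : P₁.IsChain (· ≠ ·) := hP.left_of_append
        have hQ₁ : Q₁.IsChain (· ≠ ·) := hQ.left_of_append
        rw [image_wordMap_concat, image_wordMap_concat] at heq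
        have heq' := (Set.image_injective.2 (twinGen a).injective) heq
        rw [ih Q₁ hP₁ hQ₁ heq']
      · exfalso
        refine key (P₁ ++ [a]) (Q₁ ++ [b]) ?_ (by simp) heq
        rw [List.reverse_append, List.reverse_singleton, List.singleton_append]
        refine List.IsChain.append hP ?_ ?_
        · have := isChain_ne_reverse hQ
          rw [List.reverse_append, List.reverse_singleton, List.singleton_append] at this
          exact this
        · intro x hx y hy
          rw [List.getLast?_concat] at hx
          simp only [List.head?_cons, Option.mem_def, Option.some.injEq] at hx hy
          rw [← hx, ← hy]; exact hab

end Summit.Ventures.Crystal3D.Theorems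

end
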